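import Summits.QuantumFields.YangMills.Theorems.SoloBlindRatioInput
import Literature.RepresentationTheory.CompactGroups.UnitaryTrick
import HarnessLib

/-!
# Non-trivial characters have positive Haar variance (solo-QuantumFields-blind, rung D11)

Rung D10′ (`SoloBlindRatioInput`) reduced IR-0 for a spatial plaquette field `Re tr ρ'(U_p)` to
the ratio bound `HasGaussianRatioBound` PLUS the non-degeneracy hypothesis
`0 < Var_Haar(Re tr ρ')`.  This file discharges the latter for every continuous matrix
representation `ρ'` of a compact group that is not the trivial homomorphism, in particular for
the action's own faithful unitary representation `r.ρ` of a compact simple Lie group (which is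
non-trivial because it is non-abelian).  The mechanism is elementary:

* `eq_one_of_mem_unitaryGroup_of_re_trace` — a unitary matrix `U` with `Re tr U = n` is the
  identity (rows of a unitary matrix are unit vectors, so `Re U_aa ≤ |U_aa| ≤ 1` with equality
  only if the row is the basis vector);
* `map_eq_one_of_re_trace_eq_card` — by Weyl's unitarian trick (tree:
  `CompactGroup.unitarize`, same character) the same holds for any continuous matrix
  representation of a compact group: `Re tr ρ(g) = n → ρ(g) = 1`;
* `haarVariance_pos_of_apply_ne` — a continuous real function on a compact group taking two
  different values has positive Haar variance (Haar measure charges open sets);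
* `haarVariance_re_trace_pos` — hence `0 < Var_Haar(Re tr ρ')` whenever `ρ' g ≠ 1` for some `g`;
* `correlationLengthDiverges_wilsonPlaquette_of_ratioBound` — the summit-native consequence:
  for a compact simple Lie group `G` (tree `IsSimpleCompactGroup`), every `r : LatticeRep G` and
  spatial directions `i ≠ j`, the ratio bound ALONE gives `CorrelationLengthDiverges r P` for the
  Wilson plaquette field `P = plaquetteObservable r.ρ _ i j` (IR-0 in D9's typed form).

Not decay, not IR-1; `U(1)` satisfies everything here.

References: T. Bröcker, T. tom Dieck, Representations of Compact Lie Groups (1985), II (1.7)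
(unitarian trick); S. Chatterjee, arXiv:1803.01950, Problem 5.1(b). [folklore lemmas; the
summit-native typed statements are this unit's]
-/

open MeasureTheory Filter Topology
open Literature.MathematicalPhysics.QuantumFieldTheory Literature.MathematicalPhysics.QuantumLattice
open Literature.RepresentationTheory.CompactGroups

noncomputable section

namespace Summit.QuantumFields.YangMills.Theorems.SoloBlind

/-! ### Part 1: unitary matrices with maximal real trace -/

section Unitary

variable {n : Type*} [Fintype n] [DecidableEq n]

/-- Rows of a unitary matrix have unit `ℓ²` norm: `∑_b |U_{ab}|² = 1`. [folklore] -/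
theorem sum_normSq_row_eq_one {U : Matrix n n ℂ} (hU : U ∈ Matrix.unitaryGroup n ℂ) (a : n) :
    ∑ b, Complex.normSq (U a b) = 1 := by
  have h1 : U * star U = 1 := Matrix.mem_unitaryGroup_iff.1 hU
  have h2 := congrFun (congrFun h1 a) a
  rw [Matrix.mul_apply, Matrix.one_apply_eq] at h2
  have h3 : ((∑ b, Complex.normSq (U a b) : ℝ) : ℂ) = 1 := by
    rw [← h2, Complex.ofReal_sum]
    refine Finset.sum_congr rfl fun b _ => ?_
    rw [Matrix.star_apply, Complex.star_def, Complex.mul_conj]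
  exact_mod_cast h3

/-- **A unitary matrix with `Re tr U = n` is the identity.** [folklore] -/
theorem eq_one_of_mem_unitaryGroup_of_re_trace {U : Matrix n n ℂ}
    (hU : U ∈ Matrix.unitaryGroup n ℂ) (htr : (U.trace).re = Fintype.card n) : U = 1 := by
  have hnorm : ∀ a b, ‖U a b‖ ≤ 1 := entry_norm_bound_of_unitary hU
  have hre_le : ∀ a, (U a a).re ≤ 1 := fun a => (Complex.re_le_norm _).trans (hnorm a a)
  have hsum : ∑ a, (1 - (U a a).re) = 0 := by
    have htr' : (U.trace).re = ∑ a, (U a a).re := by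
      rw [Matrix.trace]; simp only [Matrix.diag_apply, Complex.re_sum]
    rw [Finset.sum_sub_distrib, Finset.sum_const, Finset.card_univ, nsmul_eq_mul, mul_one,
      ← htr', htr, sub_self]
  have hre : ∀ a, (U a a).re = 1 := by
    intro a
    have h0 := (Finset.sum_eq_zero_iff_of_nonneg (fun b _ => sub_nonneg.2 (hre_le b))).1 hsum a
      (Finset.mem_univ a)
    linarith
  have hdiag : ∀ a, U a a = 1 := by
    intro a
    have hsq : Complex.normSq (U a a) ≤ 1 := by
      rw [Complex.normSq_eq_norm_sq]
      have h := hnorm a a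
      nlinarith [norm_nonneg (U a a)]
    rw [Complex.normSq_apply, hre a] at hsq
    have him : (U a a).im = 0 := by nlinarith [sq_nonneg (U a a).im]
    exact Complex.ext (by rw [hre a, Complex.one_re]) (by rw [him, Complex.one_im])
  have hoff : ∀ a b, a ≠ b → U a b = 0 := by
    intro a b hab
    have hrow := sum_normSq_row_eq_one hU a
    rw [← Finset.add_sum_erase _ _ (Finset.mem_univ a), hdiag a, Complex.normSq_one,
      add_eq_left] at hrow
    have h0 := (Finset.sum_eq_zero_iff_of_nonneg (fun c _ => Complex.normSq_nonneg (U a c))).1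
      hrow b (Finset.mem_erase.2 ⟨fun h => hab h.symm, Finset.mem_univ b⟩)
    exact Complex.normSq_eq_zero.1 h0
  ext a b
  by_cases hab : a = b
  · subst hab; rw [hdiag, Matrix.one_apply_eq]
  · rw [hoff a b hab, Matrix.one_apply_ne hab]

end Unitary

/-! ### Part 2: continuous matrix representations of compact groups -/

section Rep

variable {G : Type*} [Group G] [TopologicalSpace G] [IsTopologicalGroup G] [CompactSpace G]
variable {n : Type*} [Fintype n] [DecidableEq n]

/-- **`Re tr ρ(g) = n` forces `ρ(g) = 1`** for a continuous `n`-dimensional matrix representation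
of a compact group (unitarian trick: `ρ` is conjugate to a unitary representation with the same
character). [folklore] -/
theorem map_eq_one_of_re_trace_eq_card (ρ : G →* Matrix n n ℂ) (hρ : Continuous ρ) {g : G}
    (h : ((ρ g).trace).re = Fintype.card n) : ρ g = 1 := by
  have hB := CompactGroup.isUnit_det_unitarizer ρ hρ
  have hu : CompactGroup.unitarize ρ hρ g = 1 :=
    eq_one_of_mem_unitaryGroup_of_re_trace (CompactGroup.unitarize_mem_unitaryGroup ρ hρ g)
      (by rw [CompactGroup.trace_unitarize]; exact h)
  rw [CompactGroup.unitarize_apply] at hu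
  calc ρ g = (CompactGroup.unitarizer ρ hρ)⁻¹ * CompactGroup.unitarizer ρ hρ * ρ g *
        ((CompactGroup.unitarizer ρ hρ)⁻¹ * CompactGroup.unitarizer ρ hρ) := by
        rw [Matrix.nonsing_inv_mul _ hB, Matrix.one_mul, Matrix.mul_one]
    _ = (CompactGroup.unitarizer ρ hρ)⁻¹ *
        (CompactGroup.unitarizer ρ hρ * ρ g * (CompactGroup.unitarizer ρ hρ)⁻¹) *
          CompactGroup.unitarizer ρ hρ := by
        simp only [Matrix.mul_assoc]
    _ = 1 := by rw [hu, Matrix.mul_one, Matrix.nonsing_inv_mul _ hB]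

/-- If `ρ(g) ≠ 1` then `Re tr ρ(g) ≠ Re tr ρ(1)`: a non-trivial representation has a
non-constant real character. [folklore] -/
theorem re_trace_ne_of_map_ne_one (ρ : G →* Matrix n n ℂ) (hρ : Continuous ρ) {g : G}
    (hg : ρ g ≠ 1) : ((ρ g).trace).re ≠ ((ρ 1).trace).re := by
  intro h
  apply hg
  apply map_eq_one_of_re_trace_eq_card ρ hρ
  rw [h, map_one, Matrix.trace_one, Complex.natCast_re]

end Rep

/-! ### Part 3: Haar variance -/

section Variance

variable {G : Type*} [Group G] [TopologicalSpace G] [IsTopologicalGroup G] [CompactSpace G]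
  [MeasurableSpace G] [BorelSpace G]

/-- **A continuous real function on a compact group taking two different values has positive
Haar variance** (normalised Haar measure charges every non-empty open set). [folklore] -/
theorem haarVariance_pos_of_apply_ne {f : G → ℝ} (hf : Continuous f) {a b : G}
    (hab : f a ≠ f b) :
    0 < ∫ g, (f g - ∫ h, f h ∂(haarProbability G)) ^ 2 ∂(haarProbability G) := by
  haveI : (haarProbability G).IsOpenPosMeasure := by unfold haarProbability; infer_instance
  have hx : ∃ x, (f x - ∫ h, f h ∂(haarProbability G)) ^ 2 ≠ 0 := by
    by_cases ha : f a = ∫ h, f h ∂(haarProbability G)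
    · refine ⟨b, fun h0 => hab ?_⟩
      rw [ha]
      exact (sub_eq_zero.1 ((pow_eq_zero_iff two_ne_zero).1 h0)).symm
    · exact ⟨a, fun h0 => ha (sub_eq_zero.1 ((pow_eq_zero_iff two_ne_zero).1 h0))⟩
  obtain ⟨x, hx⟩ := hx
  exact Continuous.integral_pos_of_hasCompactSupport_nonneg_nonzero
    ((hf.sub continuous_const).pow 2) (HasCompactSupport.of_compactSpace _)
    (fun g => sq_nonneg _) hx

/-- **Non-trivial characters have positive Haar variance**: for a continuous matrix
representation `ρ'` of a compact group with `ρ' g ≠ 1` for some `g`,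
`0 < Var_Haar(Re tr ρ')`. [folklore] -/
theorem haarVariance_re_trace_pos {M : ℕ} (ρ' : G →* Matrix (Fin M) (Fin M) ℂ)
    (hρ' : Continuous ρ') (hne : ∃ g, ρ' g ≠ 1) :
    0 < ∫ g, ((ρ' g).trace.re - ∫ h, (ρ' h).trace.re ∂(haarProbability G)) ^ 2
      ∂(haarProbability G) := by
  obtain ⟨g, hg⟩ := hne
  exact haarVariance_pos_of_apply_ne (f := fun g => ((ρ' g).trace).re)
    (Complex.continuous_re.comp hρ'.matrix_trace) (re_trace_ne_of_map_ne_one ρ' hρ' hg)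

omit [TopologicalSpace G] [IsTopologicalGroup G] [CompactSpace G] [MeasurableSpace G]
  [BorelSpace G] in
/-- A faithful representation of a non-trivial group is a non-trivial homomorphism. [folklore] -/
theorem exists_map_ne_one_of_injective [Nontrivial G] {M : ℕ} {ρ' : G →* Matrix (Fin M) (Fin M) ℂ}
    (hρ' : Function.Injective ρ') : ∃ g, ρ' g ≠ 1 := by
  obtain ⟨g, hg⟩ := exists_ne (1 : G)
  exact ⟨g, fun h => hg (hρ' (h.trans (map_one ρ').symm))⟩

omit [IsTopologicalGroup G] [CompactSpace G] [MeasurableSpace G] [BorelSpace G] in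
/-- A simple compact group (tree `IsSimpleCompactGroup`: connected, NON-ABELIAN, no proper closed
connected normal subgroups) is non-trivial. [folklore] -/
theorem nontrivial_of_isSimpleCompactGroup (h : IsSimpleCompactGroup G) : Nontrivial G := by
  obtain ⟨a, b, hab⟩ := h.2.1
  exact nontrivial_of_ne _ _ hab

/-- The action's representation `r : LatticeRep G` of a non-trivial compact group has a plaquette
character of positive Haar variance. [folklore] -/
theorem haarVariance_re_trace_pos_of_latticeRep [Nontrivial G] (r : LatticeRep G) :
    0 < ∫ g, ((r.ρ g).trace.re - ∫ h, (r.ρ h).trace.re ∂(haarProbability G)) ^ 2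
      ∂(haarProbability G) :=
  haarVariance_re_trace_pos r.ρ r.continuous (exists_map_ne_one_of_injective r.injective)

end Variance

/-! ### Part 4: IR-0 for Wilson plaquette fields from the ratio bound alone -/

section Summit

variable {G : Type} [Group G] [TopologicalSpace G] [IsTopologicalGroup G] [CompactSpace G]
  [MeasurableSpace G] [BorelSpace G] [SecondCountableTopology G]

/-- **Ratio bound ⇒ D9's input** for the plaquette field of any NON-TRIVIAL continuous
representation `ρ'` (`i ≠ j`): the variance hypothesis of
`hasLocalGaussianRatios_plaquette_of_ratioBound` is automatic. -/
theorem hasLocalGaussianRatios_plaquette_of_ratioBound_of_ne_one (r : LatticeRep G) {M : ℕ}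
    (ρ' : G →* Matrix (Fin M) (Fin M) ℂ) (hρ' : Continuous ρ') (hne : ∃ g, ρ' g ≠ 1)
    {i j : Fin 4} (hij : i ≠ j) (h : HasGaussianRatioBound r (plaquetteObservable ρ' hρ' i j)) :
    HasLocalGaussianRatios r (plaquetteObservable ρ' hρ' i j) :=
  hasLocalGaussianRatios_plaquette_of_ratioBound r ρ' hρ' hij
    (haarVariance_re_trace_pos ρ' hρ' hne) h

/-- **IR-0 for the plaquette field of a non-trivial representation from the ratio bound alone**
(spatial `i, j ≠ 0`, `i ≠ j`). -/
theorem correlationLengthDiverges_plaquette_of_ratioBound_of_ne_one (r : LatticeRep G) {M : ℕ}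
    (ρ' : G →* Matrix (Fin M) (Fin M) ℂ) (hρ' : Continuous ρ') (hne : ∃ g, ρ' g ≠ 1)
    {i j : Fin 4} (hi : i ≠ 0) (hj : j ≠ 0) (hij : i ≠ j)
    (h : HasGaussianRatioBound r (plaquetteObservable ρ' hρ' i j)) :
    CorrelationLengthDiverges r (plaquetteObservable ρ' hρ' i j) :=
  correlationLengthDiverges_plaquette_of_ratioBound r ρ' hρ' hi hj hij
    (haarVariance_re_trace_pos ρ' hρ' hne) h

/-- **IR-0 for the Wilson plaquette field of a compact simple Lie group, from the ratio bound
alone.**  For `G` simple compact (tree `IsSimpleCompactGroup`), every lattice representation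
`r : LatticeRep G` (faithful, unitary, continuous — the data of Wilson's action in the summit
statement) and spatial directions `i, j ≠ 0`, `i ≠ j`: the ratio bound for the plaquette field
`P = plaquetteObservable r.ρ _ i j` (Theorem A + App. A of `paper/local-gaussianity.md`) implies
`CorrelationLengthDiverges r P` — no `β`-uniform torus-uniform clustering rate.  The variance
floor (D10) and the non-degeneracy of the character (this file) are theorems. -/
theorem correlationLengthDiverges_wilsonPlaquette_of_ratioBound (hG : IsSimpleCompactGroup G)
    (r : LatticeRep G) {i j : Fin 4} (hi : i ≠ 0) (hj : j ≠ 0) (hij : i ≠ j)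
    (h : HasGaussianRatioBound r (plaquetteObservable r.ρ r.continuous i j)) :
    CorrelationLengthDiverges r (plaquetteObservable r.ρ r.continuous i j) := by
  haveI := nontrivial_of_isSimpleCompactGroup hG
  exact correlationLengthDiverges_plaquette_of_ratioBound_of_ne_one r r.ρ r.continuous
    (exists_map_ne_one_of_injective r.injective) hi hj hij h

/-- The same along any weak-coupling sequence `β_k → ∞`: for every rate `m₀ > 0`, eventually in
`k` the Wilson plaquette field does not cluster torus-uniformly at rate `m₀` at coupling `β_k`. -/
theorem eventually_not_clustersAtRate_wilsonPlaquette_of_ratioBound (hG : IsSimpleCompactGroup G)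
    (r : LatticeRep G) {i j : Fin 4} (hi : i ≠ 0) (hj : j ≠ 0) (hij : i ≠ j)
    (h : HasGaussianRatioBound r (plaquetteObservable r.ρ r.continuous i j)) {m₀ : ℝ}
    (hm₀ : 0 < m₀) {βk : ℕ → ℝ} (hβ : Tendsto βk atTop atTop) :
    ∀ᶠ k in atTop, ¬ ClustersAtRate r (βk k) (plaquetteObservable r.ρ r.continuous i j)
      (plaquetteObservable r.ρ r.continuous i j) m₀ :=
  hβ.eventually
    (correlationLengthDiverges_wilsonPlaquette_of_ratioBound hG r hi hj hij h m₀ hm₀)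

end Summit

end Summit.QuantumFields.YangMills.Theorems.SoloBlind

end
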